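import Literature.NumberTheory.Irrationality.PAdicZetaValues.Basic
import Mathlib.NumberTheory.Padics.PadicNumbers
import Mathlib.Order.Filter.AtTopBot.Basic
import HarnessLib

/-!
# The elementary `p`-adic irrationality criterion for integer linear forms (Lai 2025, Lemma 2.1) — PROVED

Topic `Literature/NumberTheory/Irrationality/PAdicZetaValues`. PROOF FILE (sorry-free theorems only; no definition, no
named fact; net debt 0): the criterion through which the records of `Records.lean` for single primes are obtained
([Lai2025TwoAdicZeta, Lemma 2.1], restated as [LaiLupuSprang2025, Lemma 2.1]: "We first state an elementary irrationality
criterion in the following, which is sufficient to prove Theorem 1.1").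

[LaiLupuSprang2025, Lemma 2.1 ([Lai2025])], verbatim: "Let `ξ₀, ξ₁, …, ξ_s ∈ ℚ_p` and
`L_n(X₀, X₁, …, X_s) := l_{0,n} X₀ + l_{1,n} X₁ + ⋯ + l_{s,n} X_s ∈ ℤ[X₀, X₁, …, X_s]` be a sequence of linear forms.
Assume that there is an unbounded subset `I ⊆ ℕ` such that: (1) `max_{0 ≤ i ≤ s} |l_{i,n}| · |L_n(ξ₀, ξ₁, …, ξ_s)|_p → 0`
as `n ∈ I` and `n → ∞`, (2) `L_n(ξ₀, ξ₁, …, ξ_s) ≠ 0` for all `n ∈ I`. Then, at least one of `ξ₀, ξ₁, …, ξ_s` is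
irrational."

PROOF (the classical one, here in full): if all `ξ_i = q_i ∈ ℚ`, let `D` be the product of the denominators and
`z_i = D q_i ∈ ℤ`; then `Z_n := D · L_n(ξ) = Σ_i l_{i,n} z_i` is a NONZERO INTEGER, so `|Z_n|_p ≥ 1/|Z_n|`
(`p^{v_p(Z)} ∣ Z`), while `|Z_n| ≤ Σ_i |l_{i,n}| |z_i| ≤ max_i |l_{i,n}| · Σ_i |z_i|` and `|L_n(ξ)|_p ≥ |Z_n|_p`
(`|D|_p ≤ 1`); hence `max_i |l_{i,n}| · |L_n(ξ)|_p ≥ 1/Σ_i |z_i| > 0` for every `n ∈ I`, contradicting (1).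

## Contents
* `one_div_abs_le_norm_intCast` — `1/|Z| ≤ |Z|_p` for a nonzero integer `Z` (product-formula inequality);
* `exists_isIrrational_of_linearForms` — the `ε`-form of the criterion over any finite index type: if for every `ε > 0`
  some integer linear form `L` has `L(ξ) ≠ 0` and `|l_i| · |L(ξ)|_p < ε` for all `i`, then some `ξ_i` is irrational;
* `lai2025_lemma21` — the criterion AS PRINTED (indices `0, …, s`, an unbounded `I ⊆ ℕ`, `max_i |l_{i,n}|`, limit along
  `n ∈ I`).
-/

noncomputable section

open Filter Finset
open scoped Topology

namespace Literature.NumberTheory.Irrationality.PAdicZetaValues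

variable (p : ℕ) [Fact p.Prime]

/-- `1/|Z| ≤ |Z|_p` for a nonzero integer `Z`: `|Z|_p = p^{−v_p(Z)}` and `p^{v_p(Z)} ∣ Z`, so `p^{v_p(Z)} ≤ |Z|` (the
inequality behind every irrationality criterion: "a nonzero integer cannot be small at all places").
[cite: Calegari2005, Lemma 2.1 (proof: "`ad − bc ≡ 0 mod pⁿ` … `|ad − bc| ≥ pⁿ`")] -/
theorem one_div_abs_le_norm_intCast {Z : ℤ} (hZ : Z ≠ 0) : 1 / (|Z| : ℝ) ≤ ‖(Z : ℚ_[p])‖ := by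
  have hp : p.Prime := Fact.out
  have hp0 : (0 : ℝ) < p := by exact_mod_cast hp.pos
  set v : ℕ := padicValInt p Z with hv
  have hdvd : (p : ℤ) ^ v ∣ |Z| := (dvd_abs _ _).mpr (padicValInt_dvd Z)
  have hle : ((p : ℤ) ^ v : ℤ) ≤ |Z| := Int.le_of_dvd (abs_pos.mpr hZ) hdvd
  have hleR : (p : ℝ) ^ v ≤ (|Z| : ℝ) := by exact_mod_cast hle
  have hnorm : ‖(Z : ℚ_[p])‖ = (p : ℝ) ^ (-(v : ℤ)) := by
    rw [show ((Z : ℚ_[p])) = ((Z : ℚ) : ℚ_[p]) by norm_cast, Padic.eq_padicNorm,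
      padicNorm.eq_zpow_of_nonzero (by exact_mod_cast hZ), padicValRat.of_int]
    push_cast
    rfl
  rw [hnorm, zpow_neg, zpow_natCast, ← one_div]
  exact one_div_le_one_div_of_le (pow_pos hp0 v) hleR

/-- **The criterion, `ε`-form** (any finite index type): if for every `ε > 0` there is an integer linear form
`L = Σ_i l_i X_i` with `L(ξ) ≠ 0` and `|l_i| · |L(ξ)|_p < ε` for every `i`, then some `ξ_i ∈ ℚ_p` is irrational.
[cite: LaiLupuSprang2025, Lemma 2.1] [cite: Lai2025TwoAdicZeta, Lemma 2.1] -/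
theorem exists_isIrrational_of_linearForms {ι : Type*} [Fintype ι] (ξ : ι → ℚ_[p])
    (h : ∀ ε : ℝ, 0 < ε → ∃ l : ι → ℤ, (∑ i, (l i : ℚ_[p]) * ξ i) ≠ 0 ∧
      ∀ i, (|l i| : ℝ) * ‖∑ j, (l j : ℚ_[p]) * ξ j‖ < ε) :
    ∃ i, IsIrrational p (ξ i) := by
  classical
  by_contra hall
  push Not at hall
  -- all `ξ i` are rational: `ξ i = q i`
  have hq : ∀ i, ∃ q : ℚ, (q : ℚ_[p]) = ξ i := fun i => by
    have := hall i
    rw [isIrrational_iff] at this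
    push Not at this
    exact this
  choose q hq using hq
  -- common denominator `D` and integers `z i = D * q i`
  set D : ℕ := ∏ i, (q i).den with hD
  have hD0 : 0 < D := Finset.prod_pos fun i _ => (q i).den_pos
  set z : ι → ℤ := fun i => (q i).num * ∏ j ∈ univ.erase i, ((q j).den : ℤ) with hz
  have hzq : ∀ i, (z i : ℚ) = (D : ℚ) * q i := by
    intro i
    have h1 : (D : ℚ) = (q i).den * ∏ j ∈ univ.erase i, ((q j).den : ℚ) := by
      rw [hD]; push_cast
      exact (Finset.mul_prod_erase univ (fun j => ((q j).den : ℚ)) (Finset.mem_univ i)).symm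
    rw [h1, hz]; push_cast
    have h2 : (q i) * ((q i).den : ℚ) = (q i).num := Rat.mul_den_eq_num (q i)
    calc ((q i).num : ℚ) * ∏ j ∈ univ.erase i, ((q j).den : ℚ)
        = (q i) * ((q i).den : ℚ) * ∏ j ∈ univ.erase i, ((q j).den : ℚ) := by rw [h2]
      _ = ((q i).den : ℚ) * (∏ j ∈ univ.erase i, ((q j).den : ℚ)) * q i := by ring
  -- the positive constant `S = Σ |z i| + 1`
  set S : ℝ := ∑ i, |(z i : ℝ)| + 1 with hS
  have hS0 : 0 < S := by
    have : (0 : ℝ) ≤ ∑ i, |(z i : ℝ)| := Finset.sum_nonneg fun i _ => by positivity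
    linarith
  obtain ⟨l, hL0, hl⟩ := h (1 / S) (by positivity)
  -- `L(ξ)` is the image of the rational `Σ l_i q_i`, and `D · L(ξ)` of the integer `Z = Σ l_i z_i`
  set L : ℚ_[p] := ∑ j, (l j : ℚ_[p]) * ξ j with hLdef
  set Z : ℤ := ∑ j, l j * z j with hZ
  have hZL : (Z : ℚ_[p]) = (D : ℚ_[p]) * L := by
    have : (Z : ℚ) = (D : ℚ) * ∑ j, (l j : ℚ) * q j := by
      rw [hZ]; push_cast
      simp_rw [hzq]
      rw [Finset.mul_sum]
      refine Finset.sum_congr rfl fun j _ => by ring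
    have h' : ((Z : ℚ) : ℚ_[p]) = (((D : ℚ) * ∑ j, (l j : ℚ) * q j : ℚ) : ℚ_[p]) := by rw [this]
    push_cast at h'
    rw [h', hLdef]
    simp_rw [hq]
  have hZ0 : Z ≠ 0 := by
    intro h0
    have : (D : ℚ_[p]) * L = 0 := by rw [← hZL, h0]; simp
    rcases mul_eq_zero.mp this with h1 | h1
    · exact absurd (by exact_mod_cast h1 : D = 0) hD0.ne'
    · exact hL0 h1
  -- `|Z|_p ≤ |L|_p`
  have hnormZ : ‖(Z : ℚ_[p])‖ ≤ ‖L‖ := by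
    rw [hZL, norm_mul]
    calc ‖(D : ℚ_[p])‖ * ‖L‖ ≤ 1 * ‖L‖ := by
          gcongr
          have := Padic.norm_int_le_one (p := p) (D : ℤ)
          simpa using this
      _ = ‖L‖ := one_mul _
  -- `1 ≤ |Z| · |Z|_p ≤ (Σ |l_j| |z_j|) · |L|_p < (1/S) · Σ |z_j| < 1`
  have h1 : (1 : ℝ) ≤ |(Z : ℝ)| * ‖L‖ := by
    have habs : (0 : ℝ) < |(Z : ℝ)| := abs_pos.mpr (by exact_mod_cast hZ0)
    have := one_div_abs_le_norm_intCast p hZ0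
    calc (1 : ℝ) = |(Z : ℝ)| * (1 / |(Z : ℝ)|) := by field_simp
      _ ≤ |(Z : ℝ)| * ‖(Z : ℚ_[p])‖ := by gcongr
      _ ≤ |(Z : ℝ)| * ‖L‖ := by gcongr
  have h2 : |(Z : ℝ)| ≤ ∑ j, |(l j : ℝ)| * |(z j : ℝ)| := by
    have hint : |Z| ≤ ∑ j, |l j| * |z j| := by
      rw [hZ]
      refine (Finset.abs_sum_le_sum_abs _ _).trans (le_of_eq ?_)
      exact Finset.sum_congr rfl fun j _ => abs_mul _ _
    have := (Int.cast_le (R := ℝ)).mpr hint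
    push_cast at this
    exact this
  have h3 : (∑ j, |(l j : ℝ)| * |(z j : ℝ)|) * ‖L‖ < (1 / S) * ∑ j, |(z j : ℝ)| + (1 / S) := by
    rw [Finset.sum_mul]
    have hle : ∑ j, |(l j : ℝ)| * |(z j : ℝ)| * ‖L‖ ≤ ∑ j, (1 / S) * |(z j : ℝ)| := by
      refine Finset.sum_le_sum fun j _ => ?_
      have := (hl j).le
      calc |(l j : ℝ)| * |(z j : ℝ)| * ‖L‖ = (|(l j : ℝ)| * ‖L‖) * |(z j : ℝ)| := by ring
        _ ≤ (1 / S) * |(z j : ℝ)| := by gcongr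
    rw [← Finset.mul_sum] at hle
    have : (0 : ℝ) < 1 / S := by positivity
    linarith
  have h4 : (1 / S) * ∑ j, |(z j : ℝ)| + (1 / S) = 1 := by
    rw [hS]; field_simp
  have : (1 : ℝ) < 1 := by
    calc (1 : ℝ) ≤ |(Z : ℝ)| * ‖L‖ := h1
      _ ≤ (∑ j, |(l j : ℝ)| * |(z j : ℝ)|) * ‖L‖ := by gcongr
      _ < (1 / S) * ∑ j, |(z j : ℝ)| + (1 / S) := h3
      _ = 1 := h4
  exact lt_irrefl _ this

/-- **Lai 2025, Lemma 2.1** (= [LaiLupuSprang2025, Lemma 2.1]) (PROVED): "Let `ξ₀, ξ₁, …, ξ_s ∈ ℚ_p` and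
`L_n(X₀, …, X_s) := l_{0,n} X₀ + ⋯ + l_{s,n} X_s ∈ ℤ[X₀, …, X_s]` be a sequence of linear forms. Assume that there is an
unbounded subset `I ⊆ ℕ` such that: (1) `max_{0≤i≤s} |l_{i,n}| · |L_n(ξ₀, …, ξ_s)|_p → 0` as `n ∈ I` and `n → ∞`,
(2) `L_n(ξ₀, …, ξ_s) ≠ 0` for all `n ∈ I`. Then, at least one of `ξ₀, ξ₁, …, ξ_s` is irrational." (The limit along
`n ∈ I` is rendered by the filter `atTop ⊓ 𝓟 I`; the max by `Finset.sup'` over `Fin (s+1)`.)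
[cite: LaiLupuSprang2025, Lemma 2.1] [cite: Lai2025TwoAdicZeta, Lemma 2.1] -/
theorem lai2025_lemma21 {s : ℕ} (ξ : Fin (s + 1) → ℚ_[p]) (l : ℕ → Fin (s + 1) → ℤ) (I : Set ℕ)
    (hI : ¬ BddAbove I)
    (h1 : Tendsto (fun n => (univ.sup' univ_nonempty fun i => (|l n i| : ℝ)) *
        ‖∑ i, (l n i : ℚ_[p]) * ξ i‖) (atTop ⊓ 𝓟 I) (𝓝 0))
    (h2 : ∀ n ∈ I, (∑ i, (l n i : ℚ_[p]) * ξ i) ≠ 0) :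
    ∃ i, IsIrrational p (ξ i) := by
  refine exists_isIrrational_of_linearForms p ξ fun ε hε => ?_
  have hIinf : I.Infinite := Set.infinite_of_not_bddAbove hI
  have hfreq : ∃ᶠ n in atTop, n ∈ I := Nat.frequently_atTop_iff_infinite.mpr hIinf
  have hev : ∀ᶠ n in atTop, n ∈ I →
      (univ.sup' univ_nonempty fun i => (|l n i| : ℝ)) * ‖∑ i, (l n i : ℚ_[p]) * ξ i‖ < ε := by
    have := (h1.eventually (gt_mem_nhds hε))
    rwa [eventually_inf_principal] at this
  obtain ⟨n, hnI, hn⟩ := (hfreq.and_eventually hev).exists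
  refine ⟨l n, h2 n hnI, fun i => lt_of_le_of_lt ?_ (hn hnI)⟩
  gcongr
  exact Finset.le_sup' (fun i => (|l n i| : ℝ)) (Finset.mem_univ i)

end Literature.NumberTheory.Irrationality.PAdicZetaValues
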